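import Summits.ResolutionOfSingularities.ResolutionOfSingularities.Theses.HilbertSamuelElimination
import Summits.ResolutionOfSingularities.ResolutionOfSingularities.Theorems.HilbertSamuelEliminationSigmaMaxModificationsReductionBase
import Summits.ResolutionOfSingularities.ResolutionOfSingularities.Theorems.HilbertSamuelEliminationSigmaMaxModificationsCorridor3LevelRaiseDim
import Summits.ResolutionOfSingularities.ResolutionOfSingularities.Theorems.HilbertSamuelEliminationSigmaMaxModificationsCorridor3TameWildDefs
import Summits.ResolutionOfSingularities.ResolutionOfSingularities.Theorems.HilbertSamuelEliminationSigmaMaxModificationsGradedGlue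
import Summits.ResolutionOfSingularities.ResolutionOfSingularities.Theorems.HilbertSamuelEliminationSigmaMaxModificationsSurfaceNuMods
import Summits.ResolutionOfSingularities.ResolutionOfSingularities.Theorems.HilbertSamuelEliminationModificationsResolveDenseComplMaxLocus
import Mathlib.AlgebraicGeometry.Morphisms.Proper
import Mathlib.AlgebraicGeometry.Noetherian
import Mathlib.FieldTheory.Perfect
import HarnessLib
import Summits.ResolutionOfSingularities.ResolutionOfSingularities.Theorems.HilbertSamuelEliminationSigmaMaxModificationsNuToSigmaMax

/-!
# `SigmaMaxModificationsCorridor3` (stmt-ResolutionOfSingularities-19249) and `SigmaMaxModifications`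
# (stmt-ResolutionOfSingularities-18506), route HilbertSamuelElimination — THE REGIME GLUE, landed

[OURS · L1 W4.2] Kernel form of the value-regime decomposition D2 of
`Cruxes/SigmaMaxModificationsCorridor3/STRATEGY-CENSUS.md` = the sorry-free composition of the ACTIVE
registered skeleton `Cruxes/SigmaMaxModificationsCorridor3/Lines/tame_wild.lean` (sha 0a53f669, stubs
`stub_cjsNuElimination`, `stub_cossartPiltant2019General`, `stub_levelRaiseDim` [landed p456602],
`stub_isolatedNu3`, `stub_tameNu3`, `stub_wildNu3`), with the three open `ν`-wise regime stubs taken as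
HYPOTHESES stated verbatim (so that `sigmaMaxModificationsCorridor3_of_regimes hν hCP isolatedNu3 tameNu3
wildNu3` closes the child crux the moment the three stub files land, and the planner can file the three
regimes as separate items with this file as `--glue-by`). NOT a statement of any manuscript.

Write `B(X, N)` (`HSBody X N`, landed `TameWildDefs` p456933) for the seven-clause body of the crux at
level `N` (CJS Def. 6.15 in modification form) and `NuMod Y N d ν` for a `ν`-modification of `Y` at level
`N` inside the class `{dim ≤ d}` (CJS Def. 6.14 in modification form). The regimes of a maximal value
`ν ≠ Φ^{(3)}` of a reduced `Y/k` with `dim Y ≤ 3`: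

* ISOLATED: `Y(ν)` disjoint from `closure (Sing Y ∖ Y(ν))` — `ν`-modification from Cossart–Piltant
  (registered `stub_isolatedNu3`, provable from the named fact `CossartPiltant2019General`);
* TAME non-isolated (threefolds): `k` perfect and `ν = hypersurfaceHF m`, `m < p` (`IsTameValue p ν`) —
  registered `stub_tameNu3` (transfer of the characteristic-zero maximal-contact method, XL);
* WILD non-isolated (threefolds): the rest — registered `stub_wildNu3` (the OPEN core).

Results (all sorry-free, no new definitions):

* `nuMod_three_of_regimes` — `ν`-modifications at level `3` on the class `{dim ≤ 3}` from the CJS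
  `ν`-fact (surfaces, landed `stub_nuMods_surface_of_nuFact`) and the three regime hypotheses;
* `hsBody_of_nuMods'` — `ν`-modifications ⇒ `B(·, N)` (landed graded glue `stub_gradedGlue` + density of
  `X ∖ X_max` + sharp semicontinuity);
* `hsBody_of_dim_le_three_of_regimes` — `B(X, N)` for every `N` and every non-regular `X` of the class
  `{dim ≤ 3}` (level induction over the landed `levelRaiseDim`, curves `stub_curve`, surfaces, threefolds);
* `sigmaMaxModificationsCorridor3_of_regimes` — **the child crux `SigmaMaxModificationsCorridor3` from
  `CossartJannsenSaito2020_nuElimination`, `CossartPiltant2019General` and the three regime statements**;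
* `corridor3Base_of_regimes` — the parent's base-level core `Corridor3@3` (hypothesis `hcor` of the landed
  `sigmaMaxModifications_of_base_cores`, p164038) from the same data;
* `sigmaMaxModifications_of_regimes` — **the parent crux `SigmaMaxModifications` from the two printed
  facts, the three regime statements and the open core `DimGe4@base`** (via
  `stub_sigmaMaxElimination_of_nuElimination`, p163634, and `sigmaMaxModifications_of_base_cores`).

So, kernel-checked: modulo CJS Thm. 6.28 (ν-form) and CP 2019 Thm. 1.1, the open content of
stmt-19249 is exactly {`stub_isolatedNu3` (provable), `stub_tameNu3`, `stub_wildNu3`}, and that of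
stmt-18506 is the same plus `DimGe4@base` (stmt-19250).

## Sources

* V. Cossart, U. Jannsen, S. Saito, *Desingularization: Invariants and Strategy*, LNM 2270 (2020):
  Def. 2.28, Rem. 2.29 (b), Def. 6.14, Def. 6.15, Rem. 6.24, Thm. 6.28, Rem. 6.29. [CossartJannsenSaito2020]
* V. Cossart, O. Piltant, J. Algebra 529 (2019), Thm. 1.1. [CossartPiltant2019]
-/

set_option linter.dupNamespace false -- mandated namespace of this single-conjunct summit

noncomputable section

open CategoryTheory AlgebraicGeometry TopologicalSpace Topology
open Literature.AlgebraicGeometry.Resolution Literature.RingTheory.HilbertSamuel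
open Summit.ResolutionOfSingularities.ResolutionOfSingularities.Theses.HilbertSamuelElimination
open Summit.ResolutionOfSingularities.ResolutionOfSingularities.Theorems.SigmaMaxModifications.Sketch
open Summit.ResolutionOfSingularities.ResolutionOfSingularities.Theorems.ModificationsResolve.Sketch
open Summit.ResolutionOfSingularities.ResolutionOfSingularities.Theorems.SigmaMaxModificationsCorridor3

namespace Summit.ResolutionOfSingularities.ResolutionOfSingularities.Theorems.SigmaMaxModificationsCorridor3.TameWild

/-- **`ν`-modifications at level `3` on the class `{dim ≤ 3}`, by regime.** Surfaces (and curves):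
the CJS `ν`-fact via the landed `stub_nuMods_surface_of_nuFact`; threefolds: isolated strata by the
isolated-regime statement (from Cossart–Piltant), tame non-isolated strata by the tame statement, wild
ones by the wild statement — the three registered regime stubs of line `tame_wild`, as hypotheses.
[cite: CossartJannsenSaito2020, Def. 6.14, Thm. 6.28] [cite: CossartPiltant2019, Thm. 1.1] -/
theorem nuMod_three_of_regimes (hν : CossartJannsenSaito2020_nuElimination.{0})
    (hCP : CossartPiltant2019General.{0})
    (hIso : (CossartPiltant2019General.{0} →
      ∀ (k : Type) [Field k] (Y : Scheme.{0}) (g : Y ⟶ Spec (.of k)), IsSeparated g →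
        LocallyOfFiniteType g → QuasiCompact g → IsReduced Y →
        topologicalKrullDim Y ≤ ((3 : ℕ) : WithBot ℕ∞) →
        ∀ ν : ℕ → ℕ, Maximal (· ∈ Scheme.hsValues Y 3) ν → ν ≠ iterPSum 3 Phi →
          Disjoint (closure ((Scheme.regularLocus Y)ᶜ \ Scheme.hsStratum Y 3 ν))
            (Scheme.hsStratum Y 3 ν) →
          NuMod Y 3 3 ν))
    (hTame : (∀ p : ℕ, p.Prime → ∀ (k : Type) [Field k] [CharP k p] [PerfectField k] (Y : Scheme.{0})
      (g : Y ⟶ Spec (.of k)), IsSeparated g → LocallyOfFiniteType g → QuasiCompact g →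
      IsReduced Y → ((3 : ℕ) : WithBot ℕ∞) ≤ topologicalKrullDim Y →
      topologicalKrullDim Y ≤ ((3 : ℕ) : WithBot ℕ∞) →
      ∀ ν : ℕ → ℕ, Maximal (· ∈ Scheme.hsValues Y 3) ν → ν ≠ iterPSum 3 Phi →
        IsTameValue p ν →
        ¬ Disjoint (closure ((Scheme.regularLocus Y)ᶜ \ Scheme.hsStratum Y 3 ν))
            (Scheme.hsStratum Y 3 ν) →
        NuMod Y 3 3 ν))
    (hWild : (∀ p : ℕ, p.Prime → ∀ (k : Type) [Field k] [CharP k p] (Y : Scheme.{0})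
      (g : Y ⟶ Spec (.of k)), IsSeparated g → LocallyOfFiniteType g → QuasiCompact g →
      IsReduced Y → ((3 : ℕ) : WithBot ℕ∞) ≤ topologicalKrullDim Y →
      topologicalKrullDim Y ≤ ((3 : ℕ) : WithBot ℕ∞) →
      ∀ ν : ℕ → ℕ, Maximal (· ∈ Scheme.hsValues Y 3) ν → ν ≠ iterPSum 3 Phi →
        ¬ (PerfectField k ∧ IsTameValue p ν) →
        ¬ Disjoint (closure ((Scheme.regularLocus Y)ᶜ \ Scheme.hsStratum Y 3 ν))
            (Scheme.hsStratum Y 3 ν) →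
        NuMod Y 3 3 ν))
    (p : ℕ) (hp : p.Prime) (k : Type) [Field k] [CharP k p] :
    ∀ (Y : Scheme.{0}) (g : Y ⟶ Spec (.of k)), IsSeparated g → LocallyOfFiniteType g →
      QuasiCompact g → IsReduced Y → topologicalKrullDim Y ≤ ((3 : ℕ) : WithBot ℕ∞) →
      topologicalKrullDim Y ≤ ((3 : ℕ) : WithBot ℕ∞) →
      ∀ ν : ℕ → ℕ, Maximal (· ∈ Scheme.hsValues Y 3) ν → ν ≠ iterPSum 3 Phi →
        NuMod Y 3 3 ν := by
  intro Y g hsep hft hqc hred hd3 _ ν hν' hνΦ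
  rcases dim_le_or_succ_le (topologicalKrullDim Y) 2 with h2 | h3
  · -- surfaces (and curves) in the class: CJS ν-eliminations, raised to level `3`
    obtain ⟨Y', π, hπ, hred', hd2', hdN', hiso, hdense, hmono, hkill⟩ :=
      stub_nuMods_surface_of_nuFact hν k 3 (by norm_num) Y g hsep hft hqc hred h2 hd3 ν hν' hνΦ
    exact ⟨Y', π, hπ, hred', hd2'.trans (by exact_mod_cast (by norm_num : (2 : ℕ) ≤ 3)), hdN',
      hiso, hdense, hmono, hkill⟩
  · -- threefolds
    by_cases hdisj : Disjoint (closure ((Scheme.regularLocus Y)ᶜ \ Scheme.hsStratum Y 3 ν))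
        (Scheme.hsStratum Y 3 ν)
    · exact hIso hCP k Y g hsep hft hqc hred hd3 ν hν' hνΦ hdisj
    · by_cases ht : PerfectField k ∧ IsTameValue p ν
      · haveI := ht.1
        exact hTame p hp k Y g hsep hft hqc hred (by exact_mod_cast h3) hd3 ν hν' hνΦ ht.2 hdisj
      · exact hWild p hp k Y g hsep hft hqc hred (by exact_mod_cast h3) hd3 ν hν' hνΦ ht hdisj

/-- **From `ν`-modifications to the body `B(·, N)` on the class `{dim ≤ d} ∩ {dim ≤ N}`** (landed
graded glue `stub_gradedGlue`, CJS Def. 6.14 → Def. 6.15, plus the density of `X ∖ X_max(N)` for a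
non-regular reduced `X` with `dim X ≤ N` and the closedness of `X_max(N)` by the sharp semicontinuity).
[cite: CossartJannsenSaito2020, Def. 6.15, Rem. 6.24, Rem. 6.13] -/
theorem hsBody_of_nuMods' (k : Type) [Field k] (N d : ℕ)
    (hmod : ∀ (Y : Scheme.{0}) (g : Y ⟶ Spec (.of k)), IsSeparated g → LocallyOfFiniteType g →
      QuasiCompact g → IsReduced Y → topologicalKrullDim Y ≤ (d : WithBot ℕ∞) →
      topologicalKrullDim Y ≤ (N : WithBot ℕ∞) →
      ∀ ν : ℕ → ℕ, Maximal (· ∈ Scheme.hsValues Y N) ν → ν ≠ iterPSum N Phi → NuMod Y N d ν) :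
    ∀ (X : Scheme.{0}) (f : X ⟶ Spec (.of k)), IsSeparated f → LocallyOfFiniteType f →
      QuasiCompact f → IsReduced X → ¬ Scheme.IsRegular X →
      topologicalKrullDim X ≤ (d : WithBot ℕ∞) → topologicalKrullDim X ≤ (N : WithBot ℕ∞) →
      HSBody X N := by
  intro X f hsep hft hqc hred hreg hdimd hdim
  obtain ⟨X', π, hπ, hred', hdim', hiso, hdense, hmono, hkill⟩ :=
    stub_gradedGlue k N d hmod X f hsep hft hqc hred hreg hdimd hdim
  refine ⟨X', π, hπ, hred', hdim', hiso, ?_, hmono, hkill⟩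
  haveI := hft
  haveI := hqc
  haveI := hred
  have hcl : IsClosed (Scheme.hsMaxLocus X N) :=
    (stub_isClosed_hsMaxLocus_over_field stub_hsFun_le_of_specializes_over_field k X f hft hqc N
      hdim).2
  have hd : Dense (Scheme.hsMaxLocus X N)ᶜ := stub_dense_compl_hsMaxLocus f hreg hdim
  exact hdense ⟨(Scheme.hsMaxLocus X N)ᶜ, hcl.isOpen_compl⟩ hd subset_rfl

/-- **`B(X, N)` for every level `N` and every non-regular reduced separated finite-type `X/k` with
`dim X ≤ 3`, from the regimes.** Induction on `N`: `dim X ≤ N - 1` by the landed dimension-bounded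
level raising `levelRaiseDim` (`d = 3`, p456602); `dim X = N` a binding level — curves (`stub_curve`,
landed), surfaces at level `2` (graded glue of the CJS `ν`-fact), threefolds at level `3`
(`nuMod_three_of_regimes`). [cite: CossartJannsenSaito2020, Def. 6.15, Rem. 2.29 (b), Thm. 6.28] -/
theorem hsBody_of_dim_le_three_of_regimes (hν : CossartJannsenSaito2020_nuElimination.{0})
    (hCP : CossartPiltant2019General.{0})
    (hIso : (CossartPiltant2019General.{0} →
      ∀ (k : Type) [Field k] (Y : Scheme.{0}) (g : Y ⟶ Spec (.of k)), IsSeparated g →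
        LocallyOfFiniteType g → QuasiCompact g → IsReduced Y →
        topologicalKrullDim Y ≤ ((3 : ℕ) : WithBot ℕ∞) →
        ∀ ν : ℕ → ℕ, Maximal (· ∈ Scheme.hsValues Y 3) ν → ν ≠ iterPSum 3 Phi →
          Disjoint (closure ((Scheme.regularLocus Y)ᶜ \ Scheme.hsStratum Y 3 ν))
            (Scheme.hsStratum Y 3 ν) →
          NuMod Y 3 3 ν))
    (hTame : (∀ p : ℕ, p.Prime → ∀ (k : Type) [Field k] [CharP k p] [PerfectField k] (Y : Scheme.{0})
      (g : Y ⟶ Spec (.of k)), IsSeparated g → LocallyOfFiniteType g → QuasiCompact g →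
      IsReduced Y → ((3 : ℕ) : WithBot ℕ∞) ≤ topologicalKrullDim Y →
      topologicalKrullDim Y ≤ ((3 : ℕ) : WithBot ℕ∞) →
      ∀ ν : ℕ → ℕ, Maximal (· ∈ Scheme.hsValues Y 3) ν → ν ≠ iterPSum 3 Phi →
        IsTameValue p ν →
        ¬ Disjoint (closure ((Scheme.regularLocus Y)ᶜ \ Scheme.hsStratum Y 3 ν))
            (Scheme.hsStratum Y 3 ν) →
        NuMod Y 3 3 ν))
    (hWild : (∀ p : ℕ, p.Prime → ∀ (k : Type) [Field k] [CharP k p] (Y : Scheme.{0})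
      (g : Y ⟶ Spec (.of k)), IsSeparated g → LocallyOfFiniteType g → QuasiCompact g →
      IsReduced Y → ((3 : ℕ) : WithBot ℕ∞) ≤ topologicalKrullDim Y →
      topologicalKrullDim Y ≤ ((3 : ℕ) : WithBot ℕ∞) →
      ∀ ν : ℕ → ℕ, Maximal (· ∈ Scheme.hsValues Y 3) ν → ν ≠ iterPSum 3 Phi →
        ¬ (PerfectField k ∧ IsTameValue p ν) →
        ¬ Disjoint (closure ((Scheme.regularLocus Y)ᶜ \ Scheme.hsStratum Y 3 ν))
            (Scheme.hsStratum Y 3 ν) →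
        NuMod Y 3 3 ν))
    (p : ℕ) (hp : p.Prime) (k : Type) [Field k] [CharP k p] :
    ∀ (N : ℕ) (X : Scheme.{0}) (f : X ⟶ Spec (.of k)), IsSeparated f →
      LocallyOfFiniteType f → QuasiCompact f → IsReduced X → ¬ Scheme.IsRegular X →
      topologicalKrullDim X ≤ ((3 : ℕ) : WithBot ℕ∞) → topologicalKrullDim X ≤ (N : WithBot ℕ∞) →
      HSBody X N := by
  intro N
  induction N with
  | zero =>
    intro X f hsep hft hqc hred hreg _ hdim
    exact stub_curve stub_curveResolution k X f hsep hft hqc hred hreg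
      (hdim.trans (by exact_mod_cast (by omega : 0 ≤ 1))) 0 hdim
  | succ N ih =>
    intro X f hsep hft hqc hred hreg hd3 hdim
    rcases dim_le_or_succ_le (topologicalKrullDim X) N with h | h
    · exact levelRaiseDim k 3 N ih X f hsep hft hqc hred hreg hd3 h
    · have hN3 : N + 1 ≤ 3 := by exact_mod_cast h.trans hd3
      rcases Nat.lt_or_ge (N + 1) 2 with h1 | h2
      · exact stub_curve stub_curveResolution k X f hsep hft hqc hred hreg
          (hdim.trans (by exact_mod_cast (by omega : N + 1 ≤ 1))) (N + 1) hdim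
      rcases h2.eq_or_lt with h2 | h3
      · -- surfaces at level `2`: graded glue of the CJS ν-eliminations
        obtain rfl : N = 1 := by omega
        exact hsBody_of_nuMods' k 2 2
          (fun Y g hsep hft hqc hred hd hd' ν hν' hνΦ =>
            stub_nuMods_surface_of_nuFact hν k 2 le_rfl Y g hsep hft hqc hred hd hd' ν hν' hνΦ)
          X f hsep hft hqc hred hreg hdim hdim
      · -- threefolds at level `3`
        obtain rfl : N = 2 := by omega
        exact hsBody_of_nuMods' k 3 3 (nuMod_three_of_regimes hν hCP hIso hTame hWild p hp k) X f
          hsep hft hqc hred hreg hdim hdim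

/-- **THE REGIME GLUE for the child crux: `SigmaMaxModificationsCorridor3` (stmt-19249) follows from
the CJS `ν`-elimination fact for surfaces, Cossart–Piltant 2019, and the three `ν`-wise regime
statements `stub_isolatedNu3`, `stub_tameNu3`, `stub_wildNu3` of line `tame_wild` (stated verbatim).**
The corridor hypothesis and `3 ≤ dim X` are not used: the regimes give the body on the whole class
`{dim ≤ 3}`. [cite: CossartJannsenSaito2020, Def. 6.14, Def. 6.15, Rem. 6.29] [cite: CossartPiltant2019, Thm. 1.1] -/
theorem sigmaMaxModificationsCorridor3_of_regimes (hν : CossartJannsenSaito2020_nuElimination.{0})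
    (hCP : CossartPiltant2019General.{0})
    (hIso : (CossartPiltant2019General.{0} →
      ∀ (k : Type) [Field k] (Y : Scheme.{0}) (g : Y ⟶ Spec (.of k)), IsSeparated g →
        LocallyOfFiniteType g → QuasiCompact g → IsReduced Y →
        topologicalKrullDim Y ≤ ((3 : ℕ) : WithBot ℕ∞) →
        ∀ ν : ℕ → ℕ, Maximal (· ∈ Scheme.hsValues Y 3) ν → ν ≠ iterPSum 3 Phi →
          Disjoint (closure ((Scheme.regularLocus Y)ᶜ \ Scheme.hsStratum Y 3 ν))
            (Scheme.hsStratum Y 3 ν) →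
          NuMod Y 3 3 ν))
    (hTame : (∀ p : ℕ, p.Prime → ∀ (k : Type) [Field k] [CharP k p] [PerfectField k] (Y : Scheme.{0})
      (g : Y ⟶ Spec (.of k)), IsSeparated g → LocallyOfFiniteType g → QuasiCompact g →
      IsReduced Y → ((3 : ℕ) : WithBot ℕ∞) ≤ topologicalKrullDim Y →
      topologicalKrullDim Y ≤ ((3 : ℕ) : WithBot ℕ∞) →
      ∀ ν : ℕ → ℕ, Maximal (· ∈ Scheme.hsValues Y 3) ν → ν ≠ iterPSum 3 Phi →
        IsTameValue p ν →
        ¬ Disjoint (closure ((Scheme.regularLocus Y)ᶜ \ Scheme.hsStratum Y 3 ν))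
            (Scheme.hsStratum Y 3 ν) →
        NuMod Y 3 3 ν))
    (hWild : (∀ p : ℕ, p.Prime → ∀ (k : Type) [Field k] [CharP k p] (Y : Scheme.{0})
      (g : Y ⟶ Spec (.of k)), IsSeparated g → LocallyOfFiniteType g → QuasiCompact g →
      IsReduced Y → ((3 : ℕ) : WithBot ℕ∞) ≤ topologicalKrullDim Y →
      topologicalKrullDim Y ≤ ((3 : ℕ) : WithBot ℕ∞) →
      ∀ ν : ℕ → ℕ, Maximal (· ∈ Scheme.hsValues Y 3) ν → ν ≠ iterPSum 3 Phi →
        ¬ (PerfectField k ∧ IsTameValue p ν) →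
        ¬ Disjoint (closure ((Scheme.regularLocus Y)ᶜ \ Scheme.hsStratum Y 3 ν))
            (Scheme.hsStratum Y 3 ν) →
        NuMod Y 3 3 ν)) :
    SigmaMaxModificationsCorridor3 := by
  intro p hp k _ _ X f hsep hft hqc hred hreg _ h3' N hdim _ _
  exact hsBody_of_dim_le_three_of_regimes hν hCP hIso hTame hWild p hp k N X f hsep hft hqc hred hreg
    h3' hdim

/-- **The parent's base-level core `Corridor3@3`** (the hypothesis `hcor` of the landed
`sigmaMaxModifications_of_base_cores`, p164038: corridor threefolds at the binding level `N = 3`, in the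
`Scheme.hsFun / hsMaxLocus / hsValues` vocabulary) **from the regimes.**
[cite: CossartJannsenSaito2020, Def. 6.15, Rem. 6.29] -/
theorem corridor3Base_of_regimes (hν : CossartJannsenSaito2020_nuElimination.{0})
    (hCP : CossartPiltant2019General.{0})
    (hIso : (CossartPiltant2019General.{0} →
      ∀ (k : Type) [Field k] (Y : Scheme.{0}) (g : Y ⟶ Spec (.of k)), IsSeparated g →
        LocallyOfFiniteType g → QuasiCompact g → IsReduced Y →
        topologicalKrullDim Y ≤ ((3 : ℕ) : WithBot ℕ∞) →
        ∀ ν : ℕ → ℕ, Maximal (· ∈ Scheme.hsValues Y 3) ν → ν ≠ iterPSum 3 Phi →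
          Disjoint (closure ((Scheme.regularLocus Y)ᶜ \ Scheme.hsStratum Y 3 ν))
            (Scheme.hsStratum Y 3 ν) →
          NuMod Y 3 3 ν))
    (hTame : (∀ p : ℕ, p.Prime → ∀ (k : Type) [Field k] [CharP k p] [PerfectField k] (Y : Scheme.{0})
      (g : Y ⟶ Spec (.of k)), IsSeparated g → LocallyOfFiniteType g → QuasiCompact g →
      IsReduced Y → ((3 : ℕ) : WithBot ℕ∞) ≤ topologicalKrullDim Y →
      topologicalKrullDim Y ≤ ((3 : ℕ) : WithBot ℕ∞) →
      ∀ ν : ℕ → ℕ, Maximal (· ∈ Scheme.hsValues Y 3) ν → ν ≠ iterPSum 3 Phi →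
        IsTameValue p ν →
        ¬ Disjoint (closure ((Scheme.regularLocus Y)ᶜ \ Scheme.hsStratum Y 3 ν))
            (Scheme.hsStratum Y 3 ν) →
        NuMod Y 3 3 ν))
    (hWild : (∀ p : ℕ, p.Prime → ∀ (k : Type) [Field k] [CharP k p] (Y : Scheme.{0})
      (g : Y ⟶ Spec (.of k)), IsSeparated g → LocallyOfFiniteType g → QuasiCompact g →
      IsReduced Y → ((3 : ℕ) : WithBot ℕ∞) ≤ topologicalKrullDim Y →
      topologicalKrullDim Y ≤ ((3 : ℕ) : WithBot ℕ∞) →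
      ∀ ν : ℕ → ℕ, Maximal (· ∈ Scheme.hsValues Y 3) ν → ν ≠ iterPSum 3 Phi →
        ¬ (PerfectField k ∧ IsTameValue p ν) →
        ¬ Disjoint (closure ((Scheme.regularLocus Y)ᶜ \ Scheme.hsStratum Y 3 ν))
            (Scheme.hsStratum Y 3 ν) →
        NuMod Y 3 3 ν)) :
    (∀ p : ℕ, p.Prime → ∀ (k : Type) [Field k] [CharP k p] (X : Scheme.{0})
      (f : X ⟶ Spec (.of k)), IsSeparated f → LocallyOfFiniteType f → QuasiCompact f →
      IsReduced X → ¬ Scheme.IsRegular X → ((3 : ℕ) : WithBot ℕ∞) ≤ topologicalKrullDim X →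
      topologicalKrullDim X ≤ ((3 : ℕ) : WithBot ℕ∞) →
      ¬ Disjoint (closure ((Scheme.regularLocus X)ᶜ \ Scheme.hsMaxLocus X 3))
          (Scheme.hsMaxLocus X 3) →
        ∃ (X' : Scheme.{0}) (π : X' ⟶ X), IsProper π ∧ IsReduced X' ∧
          topologicalKrullDim X' ≤ ((3 : ℕ) : WithBot ℕ∞) ∧
          (∀ U : X.Opens, (U : Set X) ⊆ (Scheme.hsMaxLocus X 3)ᶜ → IsIso (π ∣_ U)) ∧
          Dense ((fun x' => π.base x') ⁻¹' (Scheme.hsMaxLocus X 3)ᶜ) ∧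
          (∀ x' : X', Scheme.hsFun X' 3 x' ≤ Scheme.hsFun X 3 (π.base x')) ∧
          ∀ ν : ℕ → ℕ, Maximal (· ∈ Scheme.hsValues X 3) ν → ν ∉ Scheme.hsValues X' 3) := by
  intro p hp k _ _ X f hsep hft hqc hred hreg _ hle _
  exact hsBody_of_dim_le_three_of_regimes hν hCP hIso hTame hWild p hp k 3 X f hsep hft hqc hred hreg
    hle hle

/-- **THE REGIME GLUE for the parent crux: `SigmaMaxModifications` (stmt-18506) follows from the two
printed facts (CJS Thm. 6.28 in `ν`-form, CP 2019 Thm. 1.1), the three `ν`-wise regime statements of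
line `tame_wild`, and the open core `DimGe4@base` (`Σ^max`-modifications at level `N = dim X ≥ 4`,
stmt-19250).** Composition of `corridor3Base_of_regimes` with the landed
`stub_sigmaMaxElimination_of_nuElimination` (p163634) and `sigmaMaxModifications_of_base_cores`
(p164038). [cite: CossartJannsenSaito2020, Def. 6.15, Cor. 6.18, Rem. 6.29] [cite: CossartPiltant2019, Thm. 1.1] -/
theorem sigmaMaxModifications_of_regimes (hν : CossartJannsenSaito2020_nuElimination.{0})
    (hCP : CossartPiltant2019General.{0})
    (hIso : (CossartPiltant2019General.{0} →
      ∀ (k : Type) [Field k] (Y : Scheme.{0}) (g : Y ⟶ Spec (.of k)), IsSeparated g →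
        LocallyOfFiniteType g → QuasiCompact g → IsReduced Y →
        topologicalKrullDim Y ≤ ((3 : ℕ) : WithBot ℕ∞) →
        ∀ ν : ℕ → ℕ, Maximal (· ∈ Scheme.hsValues Y 3) ν → ν ≠ iterPSum 3 Phi →
          Disjoint (closure ((Scheme.regularLocus Y)ᶜ \ Scheme.hsStratum Y 3 ν))
            (Scheme.hsStratum Y 3 ν) →
          NuMod Y 3 3 ν))
    (hTame : (∀ p : ℕ, p.Prime → ∀ (k : Type) [Field k] [CharP k p] [PerfectField k] (Y : Scheme.{0})
      (g : Y ⟶ Spec (.of k)), IsSeparated g → LocallyOfFiniteType g → QuasiCompact g →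
      IsReduced Y → ((3 : ℕ) : WithBot ℕ∞) ≤ topologicalKrullDim Y →
      topologicalKrullDim Y ≤ ((3 : ℕ) : WithBot ℕ∞) →
      ∀ ν : ℕ → ℕ, Maximal (· ∈ Scheme.hsValues Y 3) ν → ν ≠ iterPSum 3 Phi →
        IsTameValue p ν →
        ¬ Disjoint (closure ((Scheme.regularLocus Y)ᶜ \ Scheme.hsStratum Y 3 ν))
            (Scheme.hsStratum Y 3 ν) →
        NuMod Y 3 3 ν))
    (hWild : (∀ p : ℕ, p.Prime → ∀ (k : Type) [Field k] [CharP k p] (Y : Scheme.{0})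
      (g : Y ⟶ Spec (.of k)), IsSeparated g → LocallyOfFiniteType g → QuasiCompact g →
      IsReduced Y → ((3 : ℕ) : WithBot ℕ∞) ≤ topologicalKrullDim Y →
      topologicalKrullDim Y ≤ ((3 : ℕ) : WithBot ℕ∞) →
      ∀ ν : ℕ → ℕ, Maximal (· ∈ Scheme.hsValues Y 3) ν → ν ≠ iterPSum 3 Phi →
        ¬ (PerfectField k ∧ IsTameValue p ν) →
        ¬ Disjoint (closure ((Scheme.regularLocus Y)ᶜ \ Scheme.hsStratum Y 3 ν))
            (Scheme.hsStratum Y 3 ν) →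
        NuMod Y 3 3 ν))
    (hge4 : (∀ p : ℕ, p.Prime → ∀ (k : Type) [Field k] [CharP k p] (X : Scheme.{0})
      (f : X ⟶ Spec (.of k)), IsSeparated f → LocallyOfFiniteType f → QuasiCompact f →
      IsReduced X → ¬ Scheme.IsRegular X → ∀ N : ℕ, 4 ≤ N →
      (N : WithBot ℕ∞) ≤ topologicalKrullDim X → topologicalKrullDim X ≤ (N : WithBot ℕ∞) →
        ∃ (X' : Scheme.{0}) (π : X' ⟶ X), IsProper π ∧ IsReduced X' ∧
          topologicalKrullDim X' ≤ ((N : ℕ) : WithBot ℕ∞) ∧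
          (∀ U : X.Opens, (U : Set X) ⊆ (Scheme.hsMaxLocus X N)ᶜ → IsIso (π ∣_ U)) ∧
          Dense ((fun x' => π.base x') ⁻¹' (Scheme.hsMaxLocus X N)ᶜ) ∧
          (∀ x' : X', Scheme.hsFun X' N x' ≤ Scheme.hsFun X N (π.base x')) ∧
          ∀ ν : ℕ → ℕ, Maximal (· ∈ Scheme.hsValues X N) ν → ν ∉ Scheme.hsValues X' N)) :
    SigmaMaxModifications :=
  sigmaMaxModifications_of_base_cores (stub_sigmaMaxElimination_of_nuElimination hν) hCP
    (corridor3Base_of_regimes hν hCP hIso hTame hWild) hge4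

end Summit.ResolutionOfSingularities.ResolutionOfSingularities.Theorems.SigmaMaxModificationsCorridor3.TameWild

end
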